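import Mathlib
import Summits.SmoothPoincare4.SmoothPoincare4.Theorems.ConvexBisectionAcyclicBisectionExistsMultiAttachmentHomologyMV
import Summits.SmoothPoincare4.SmoothPoincare4.Theorems.ConvexBisectionAcyclicBisectionExistsMultiAttachmentHomologyLoops
import HarnessLib

/-!
# `H₁` of a space covered by an open piece `A` and finitely many disjoint acyclic open pieces:
# `H₁(X) ≅ H₁(A) ⧸ ⟨one class per piece⟩`
(helper for stub `stub_isLefschetzHandlebody_homology` = NF5
`Literature.Topology.FourManifolds.LefschetzBase.isLefschetzHandlebody_homology`, line
`modp-braid-orbits` r9, crux `ConvexBisection.AcyclicBisectionExists`, item stmt-SmoothPoincare4-10508;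
wave 3 / W3-2: the COVER half of `H₁(V ∪ 2-handles) = H₁(V)/⟨attaching circles⟩`,
Gompf–Stipsicz 1999 §4.4, for Kosinski multi-attachments of `HandleAttachingMap 3 2`)

Kosinski's model of a multi-attachment `X = V ∪ H² ∪ ⋯ ∪ H²` (VI §6,
`HandleAttachingMap.IsMultiAttachment`) is covered by the open sets `A = jA(V ∖ ⋃ cores)` and
`Bᵢ = jBᵢ(D⁴ ∖ S)`, the `Bᵢ` pairwise disjoint, contractible, and meeting `A` in the connected
punctured tubes `jBᵢ(T ∖ S)` whose `H₁` is carried onto the span of the `i`-th attaching class.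
This file does the bookkeeping of the iterated Mayer–Vietoris steps
(`surjective_map_one_union`, `ker_map_one_union` of `…MultiAttachmentHomologyMV.lean`;
`ker_comp_eq_sup` of `…MultiAttachmentHomologyLoops.lean`) over such a cover, abstractly:

* **`surjective_and_ker_cover`** — for `X = A ∪ ⋃ᵢ Bᵢ` with `A`, `Bᵢ` open, the `Bᵢ` pairwise
  disjoint and path connected with `H₁(Bᵢ) = 0`, the `A ∩ Bᵢ` path connected, and
  `im (H₁(A ∩ Bᵢ) → H₁(A)) = R ∙ cᵢ`: the map `H₁(A; R) → H₁(X; R)` is onto with kernel the span of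
  the `cᵢ` (Finset induction over the pieces: `A ∪ ⋃_{j ∈ s} Bⱼ` meets the next piece `Bᵢ` in
  `A ∩ Bᵢ`); hence `H₁(X) ≅ H₁(A) ⧸ span {cᵢ}` (`nonempty_equiv_quot_cover`);
* the registered sub-goal stub `stub_multiAttachment_coverH1`.

Everything is proved; no named facts, no `sorry`, no definitions.  References: A. Hatcher,
*Algebraic Topology* (2002), §2.2 pp. 149–150 [HatcherAT2002]; R. E. Gompf, A. I. Stipsicz,
*4-Manifolds and Kirby Calculus* (1999), §4.4 [GompfStipsicz1999]; A. A. Kosinski,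
*Differential Manifolds* (1993), VI §6 [Kosinski1993].
-/

noncomputable section

-- the prescribed namespace `Summit.<P>.<Sub>.…` duplicates `SmoothPoincare4` (P = Sub)
set_option linter.dupNamespace false

open Set Function CategoryTheory CategoryTheory.Limits
open Literature.AlgebraicTopology.SingularHomology

namespace Summit.SmoothPoincare4.SmoothPoincare4.Theorems.AcyclicBisectionExists.ModpBraidOrbits

universe u v

variable (R : Type v) [CommRing R] {X : Type u} [TopologicalSpace X]

/-! ## §1 Bookkeeping of inclusions on `H₁` -/

/-- Mutually inclusive subsets: the inclusion is onto on `H₁` with trivial kernel. [folklore] -/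
theorem surjective_and_ker_of_subset {A P : Set X} (hAP : A ⊆ P) (hPA : P ⊆ A) :
    Function.Surjective (singularHomology.map R R (subsetInclusion hAP) 1) ∧
      LinearMap.ker (singularHomology.map R R (subsetInclusion hAP) 1).hom = ⊥ := by
  have hl : (subsetInclusion hPA).comp (subsetInclusion hAP) = ContinuousMap.id _ := by ext; rfl
  have hr : (subsetInclusion hAP).comp (subsetInclusion hPA) = ContinuousMap.id _ := by ext; rfl
  have h₁ : singularHomology.map R R (subsetInclusion hAP) 1 ≫
      singularHomology.map R R (subsetInclusion hPA) 1 = 𝟙 _ := by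
    rw [← singularHomology.map_comp, hl, singularHomology.map_id]
  have h₂ : singularHomology.map R R (subsetInclusion hPA) 1 ≫
      singularHomology.map R R (subsetInclusion hAP) 1 = 𝟙 _ := by
    rw [← singularHomology.map_comp, hr, singularHomology.map_id]
  refine ⟨fun y => ⟨singularHomology.map R R (subsetInclusion hPA) 1 y, ?_⟩,
    LinearMap.ker_eq_bot.2 fun a b hab => ?_⟩
  · rw [← ModuleCat.comp_apply, h₂, ModuleCat.id_apply]
  · have e := congrArg (singularHomology.map R R (subsetInclusion hPA) 1) hab
    rwa [← ModuleCat.comp_apply, ← ModuleCat.comp_apply, h₁, ModuleCat.id_apply,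
      ModuleCat.id_apply] at e

/-- `Hₙ(univ) → Hₙ(X)` is onto with trivial kernel (a homeomorphism). [folklore] -/
theorem surjective_and_ker_univ (n : ℕ) :
    Function.Surjective (singularHomology.map R R (subsetIncl (univ : Set X)) n) ∧
      LinearMap.ker (singularHomology.map R R (subsetIncl (univ : Set X)) n).hom = ⊥ := by
  have e : singularHomology.map R R (subsetIncl (univ : Set X)) n =
      (singularHomology.mapIso R R (Homeomorph.Set.univ X) n).hom := by
    rw [singularHomology.mapIso_hom]; rfl
  rw [e]
  have hb := (ConcreteCategory.isIso_iff_bijective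
    (singularHomology.mapIso R R (Homeomorph.Set.univ X) n).hom).1 inferInstance
  exact ⟨hb.2, LinearMap.ker_eq_bot.2 hb.1⟩

/-- Equal subsets of `P` have the same image in `H₁(P)`. [folklore] -/
theorem range_map_congr_set {S T P : Set X} (hST : S = T) (hS : S ⊆ P) (hT : T ⊆ P) (n : ℕ) :
    LinearMap.range (singularHomology.map R R (subsetInclusion hS) n).hom =
      LinearMap.range (singularHomology.map R R (subsetInclusion hT) n).hom := by
  subst hST; rfl

/-- Composition of inclusions on homology, on `hom`s. [folklore] -/
theorem hom_map_comp_subsetInclusion {S P Q : Set X} (hSP : S ⊆ P) (hPQ : P ⊆ Q) (n : ℕ) :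
    (singularHomology.map R R (subsetInclusion (hSP.trans hPQ)) n).hom =
      (singularHomology.map R R (subsetInclusion hPQ) n).hom ∘ₗ
        (singularHomology.map R R (subsetInclusion hSP) n).hom := by
  rw [← ModuleCat.hom_comp, ← singularHomology.map_comp]; rfl

/-! ## §2 The iterated Mayer–Vietoris steps -/

section Cover

variable {ι : Type*} {A : Set X} {B : ι → Set X} {c : ι → singularHomology R R ↥A 1}

/-- **Finset induction over the acyclic pieces.**  Under the hypotheses of
`surjective_and_ker_cover` (except the covering one), for every finite set `s` of pieces the map
`H₁(A) → H₁(A ∪ ⋃_{i ∈ s} Bᵢ)` is onto with kernel the span of the `cᵢ`, `i ∈ s`.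
[cite: HatcherAT2002, §2.2 p. 149] -/
theorem surjective_and_ker_finset (hA : IsOpen A) (hB : ∀ i, IsOpen (B i))
    (hdisj : Pairwise fun i j => Disjoint (B i) (B j))
    (hpcI : ∀ i, PathConnectedSpace ↥(A ∩ B i)) (hpcB : ∀ i, PathConnectedSpace ↥(B i))
    (hB1 : ∀ i, IsZero (singularHomology R R ↥(B i) 1))
    (hc : ∀ i, LinearMap.range (singularHomology.map R R
      (subsetInclusion (inter_subset_left : A ∩ B i ⊆ A)) 1).hom = Submodule.span R {c i})
    (s : Finset ι) : ∀ (P : Set X) (hP : A ⊆ P), P = A ∪ ⋃ i ∈ s, B i →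
      Function.Surjective (singularHomology.map R R (subsetInclusion hP) 1) ∧
      LinearMap.ker (singularHomology.map R R (subsetInclusion hP) 1).hom =
        Submodule.span R (c '' (s : Set ι)) := by
  classical
  induction s using Finset.induction_on with
  | empty =>
    intro P hP hPe
    have hPA : P ⊆ A := by rw [hPe]; simp
    rw [Finset.coe_empty, image_empty, Submodule.span_empty]
    exact surjective_and_ker_of_subset R hP hPA
  | @insert i s his ih =>
    intro P hP hPe
    set Q : Set X := A ∪ ⋃ i ∈ s, B i with hQ
    have hAQ : A ⊆ Q := subset_union_left
    obtain rfl : P = Q ∪ B i := by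
      rw [hPe, hQ, Finset.set_biUnion_insert]; ac_rfl
    obtain ⟨hsF, hkF⟩ := ih Q hAQ rfl
    -- the next piece meets what is there in `A ∩ Bᵢ`
    have hQi : Q ∩ B i = A ∩ B i := by
      rw [hQ, union_inter_distrib_right]
      refine union_eq_left.2 ?_
      rintro a ⟨ha, hai⟩
      obtain ⟨j, hj, haj⟩ := mem_iUnion₂.1 ha
      have hji : j ≠ i := fun e => his (e ▸ hj)
      exact absurd hai (Set.disjoint_left.1 (hdisj hji) haj)
    have hQo : IsOpen Q := hA.union (isOpen_biUnion fun i _ => hB i)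
    haveI : PathConnectedSpace ↥(Q ∩ B i) := by rw [hQi]; exact hpcI i
    haveI := hpcB i
    -- the Mayer–Vietoris step
    have hsG := surjective_map_one_union R R hQo (hB i) (hB1 i)
    have hkG := ker_map_one_union R R hQo (hB i) (hB1 i)
    -- its kernel is the image of `R ∙ cᵢ`
    have hkG' : LinearMap.ker (singularHomology.map R R
        (subsetInclusion (subset_union_left : Q ⊆ Q ∪ B i)) 1).hom =
        Submodule.map (singularHomology.map R R (subsetInclusion hAQ) 1).hom
          (Submodule.span R {c i}) := by
      rw [hkG, range_map_congr_set R hQi inter_subset_left (inter_subset_left.trans hAQ) 1,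
        hom_map_comp_subsetInclusion R (inter_subset_left : A ∩ B i ⊆ A) hAQ 1,
        LinearMap.range_comp, hc i]
    -- compose
    have hfac : (singularHomology.map R R (subsetInclusion hP) 1).hom =
        (singularHomology.map R R (subsetInclusion (subset_union_left : Q ⊆ Q ∪ B i)) 1).hom ∘ₗ
          (singularHomology.map R R (subsetInclusion hAQ) 1).hom :=
      hom_map_comp_subsetInclusion R hAQ subset_union_left 1
    refine ⟨?_, ?_⟩
    · show Function.Surjective (singularHomology.map R R (subsetInclusion hP) 1).hom
      rw [hfac]
      exact hsG.comp hsF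
    · rw [hfac, ker_comp_eq_sup hkF hkG', Finset.coe_insert, image_insert_eq, Submodule.span_insert]

/-- **`H₁` of a space covered by an open piece `A` and finitely many disjoint acyclic open
pieces.**  Let `X = A ∪ ⋃ᵢ Bᵢ` with `A`, `Bᵢ` open, the `Bᵢ` pairwise disjoint and path
connected with `H₁(Bᵢ; R) = 0`, the `A ∩ Bᵢ` path connected, and let the image of
`H₁(A ∩ Bᵢ; R) → H₁(A; R)` be `R ∙ cᵢ`.  Then `H₁(A; R) → H₁(X; R)` is onto with kernel the span
of the `cᵢ` (Gompf–Stipsicz 1999, §4.4: `H₁(X ∪ 2-handles) = H₁(X)/⟨attaching circles⟩`).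
[cite: HatcherAT2002, §2.2 p. 149] -/
theorem surjective_and_ker_cover [Finite ι] (hA : IsOpen A) (hB : ∀ i, IsOpen (B i))
    (hdisj : Pairwise fun i j => Disjoint (B i) (B j)) (hcov : A ∪ ⋃ i, B i = univ)
    (hpcI : ∀ i, PathConnectedSpace ↥(A ∩ B i)) (hpcB : ∀ i, PathConnectedSpace ↥(B i))
    (hB1 : ∀ i, IsZero (singularHomology R R ↥(B i) 1))
    (hc : ∀ i, LinearMap.range (singularHomology.map R R
      (subsetInclusion (inter_subset_left : A ∩ B i ⊆ A)) 1).hom = Submodule.span R {c i}) :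
    Function.Surjective (singularHomology.map R R (subsetIncl A) 1) ∧
      LinearMap.ker (singularHomology.map R R (subsetIncl A) 1).hom =
        Submodule.span R (range c) := by
  haveI := Fintype.ofFinite ι
  have hcov' : (univ : Set X) = A ∪ ⋃ i ∈ (Finset.univ : Finset ι), B i := by
    rw [← hcov]
    congr 1
    ext x
    simp
  obtain ⟨hs, hk⟩ := surjective_and_ker_finset R hA hB hdisj hpcI hpcB hB1 hc Finset.univ univ
    (subset_univ A) hcov'
  rw [Finset.coe_univ, image_univ] at hk
  obtain ⟨hsu, hku⟩ := surjective_and_ker_univ R (X := X) 1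
  have hfac : (singularHomology.map R R (subsetIncl A) 1).hom =
      (singularHomology.map R R (subsetIncl (univ : Set X)) 1).hom ∘ₗ
        (singularHomology.map R R (subsetInclusion (subset_univ A)) 1).hom := by
    rw [← ModuleCat.hom_comp, ← singularHomology.map_comp]; rfl
  refine ⟨?_, ?_⟩
  · show Function.Surjective (singularHomology.map R R (subsetIncl A) 1).hom
    rw [hfac]
    exact hsu.comp hs
  · rw [hfac, LinearMap.ker_comp_of_ker_eq_bot _ hku, hk]

/-- **`H₁(X; R) ≅ H₁(A; R) ⧸ span {cᵢ}`** under the hypotheses of `surjective_and_ker_cover`.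
[cite: GompfStipsicz1999, §4.4] -/
theorem nonempty_equiv_quot_cover [Finite ι] (hA : IsOpen A) (hB : ∀ i, IsOpen (B i))
    (hdisj : Pairwise fun i j => Disjoint (B i) (B j)) (hcov : A ∪ ⋃ i, B i = univ)
    (hpcI : ∀ i, PathConnectedSpace ↥(A ∩ B i)) (hpcB : ∀ i, PathConnectedSpace ↥(B i))
    (hB1 : ∀ i, IsZero (singularHomology R R ↥(B i) 1))
    (hc : ∀ i, LinearMap.range (singularHomology.map R R
      (subsetInclusion (inter_subset_left : A ∩ B i ⊆ A)) 1).hom = Submodule.span R {c i}) :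
    Nonempty (singularHomology R R X 1 ≃ₗ[R] singularHomology R R ↥A 1 ⧸ Submodule.span R (range c)) :=
  nonempty_equiv_quot_of_surjective (surjective_and_ker_cover R hA hB hdisj hcov hpcI hpcB hB1 hc).1
    (surjective_and_ker_cover R hA hB hdisj hcov hpcI hpcB hB1 hc).2

end Cover

/-! ## §3 The registered sub-goal stub -/

/-- **Cover half of the multi-attachment `H₁` engine** (registered sub-goal stub
`stub_multiAttachment_coverH1` of `stub_isLefschetzHandlebody_homology`): for
`X = A ∪ ⋃ᵢ Bᵢ` with `A`, `Bᵢ` open, the `Bᵢ` pairwise disjoint and path connected with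
`H₁(Bᵢ; R) = 0`, the `A ∩ Bᵢ` path connected, and `im (H₁(A ∩ Bᵢ) → H₁(A)) = R ∙ cᵢ`, the map
`H₁(A; R) → H₁(X; R)` is onto with kernel `span {cᵢ}` — applied to Kosinski's cover
`A = jA(V ∖ ⋃ cores)`, `Bᵢ = jBᵢ(D⁴ ∖ S)` of a multi-attachment of 2-handles this is
`H₁(V ∪ 2-handles) = H₁(V)/⟨attaching circles⟩` (Gompf–Stipsicz 1999, §4.4).
[cite: HatcherAT2002, §2.2 p. 149] -/
theorem stub_multiAttachment_coverH1 : ∀ (R : Type) [CommRing R] (X : Type) [TopologicalSpace X]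
    (ι : Type) [Finite ι] (A : Set X) (B : ι → Set X)
    (c : ι → Literature.AlgebraicTopology.SingularHomology.singularHomology R R ↥A 1),
    IsOpen A → (∀ i, IsOpen (B i)) → Pairwise (fun i j => Disjoint (B i) (B j)) →
    A ∪ (⋃ i, B i) = Set.univ → (∀ i, PathConnectedSpace ↥(A ∩ B i)) →
    (∀ i, PathConnectedSpace ↥(B i)) →
    (∀ i, CategoryTheory.Limits.IsZero
      (Literature.AlgebraicTopology.SingularHomology.singularHomology R R ↥(B i) 1)) →
    (∀ i, LinearMap.range (Literature.AlgebraicTopology.SingularHomology.singularHomology.map R R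
      (Literature.AlgebraicTopology.SingularHomology.subsetInclusion
        (Set.inter_subset_left : A ∩ B i ⊆ A)) 1).hom = Submodule.span R {c i}) →
    Function.Surjective (Literature.AlgebraicTopology.SingularHomology.singularHomology.map R R
      (Literature.AlgebraicTopology.SingularHomology.subsetIncl A) 1) ∧
    LinearMap.ker (Literature.AlgebraicTopology.SingularHomology.singularHomology.map R R
      (Literature.AlgebraicTopology.SingularHomology.subsetIncl A) 1).hom =
      Submodule.span R (Set.range c) :=
  fun R _ _ _ _ _ _ _ _ hA hB hdisj hcov hpcI hpcB hB1 hc =>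
    surjective_and_ker_cover R hA hB hdisj hcov hpcI hpcB hB1 hc

end Summit.SmoothPoincare4.SmoothPoincare4.Theorems.AcyclicBisectionExists.ModpBraidOrbits
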